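import Literature.Analysis.Hypoelliptic.ShadowLin
import Literature.Analysis.Hypoelliptic.FourierSupBound
import Literature.Analysis.Distribution.Hypoelliptic
import HarnessLib

/-!
# Smoothness: a localized distribution whose Fourier side is `Nice` is a smooth function

Analysis/Hypoelliptic support file serving the discharge of
`Literature.Analysis.Distribution.Hormander1967_thm11` (the last interface step, "I3": from
`G_ζ ∈ ⋂_t Ĥ^t` back to `u ∈ C^∞` where `ζ = 1`).

Let `G` represent the identity w.r.t. `u, ζ, T` (`ShadowLin.Rep`) with `G ∈ Nice` (all weighted
norms finite), `T : E ≃L[ℝ] V`, and `∫ g ∘ T dμ = c_T ∫ g` with `c_T ≠ 0`. Then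

* `G` is integrable with all moments, so `𝓕 G` is smooth (`contDiff_fourier_of_nice`);
* for a test function `φ` with `ζ φ = φ`:
  `u φ = ∫ g φ dμ` with `g = Re (c_T⁻¹' · 𝓕 G ∘ T)` (`Rep.integral_eq`), by the representation
  identity, the change of variables and Fubini;
* hence (**`Rep.isSmoothOn`**) `u` is a smooth function on every open set on which `ζ = 1`.

## References

* L. Hörmander, *The Analysis of Linear Partial Differential Operators I*, Lemma 7.1.3, Thm 7.1.5
  (folklore).
-/

noncomputable section

open MeasureTheory Set Filter Function SchwartzMap TopologicalSpace Distributions TestFunction Real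
open scoped ENNReal NNReal Topology ComplexConjugate InnerProductSpace FourierTransform BigOperators
  ContDiff

namespace Literature.Analysis.Hypoelliptic

variable {V : Type*} [NormedAddCommGroup V] [InnerProductSpace ℝ V] [FiniteDimensional ℝ V]
  [MeasurableSpace V] [BorelSpace V]

/-! ### Nice functions are integrable with all moments -/

/-- `∫ ⟨v⟩^p ‖G v‖ < ∞` for `G ∈ Nice`. [folklore] -/
theorem integrable_bw_mul_norm_of_nice {G : V → ℂ} (hG : Nice G) (p : ℝ) :
    Integrable (fun v : V => bw p v * ‖G v‖) (volume : Measure V) := by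
  set r : ℝ := (Module.finrank ℝ V : ℝ) / 2 + 1 with hr
  have hr' : (Module.finrank ℝ V : ℝ) < 2 * r := by rw [hr]; linarith
  have hm : AEStronglyMeasurable (fun v : V => bw p v * ‖G v‖) volume :=
    (continuous_bw p).aestronglyMeasurable.mul hG.1.norm
  refine ⟨hm, ?_⟩
  have h := lintegral_bw_norm_le p r hG.1
  have hfin : decayL2 V r * wnorm (p + r) G < ⊤ := ENNReal.mul_lt_top (decayL2_lt_top hr') (hG.2 _)
  refine lt_of_le_of_lt ?_ (h.trans_lt hfin)
  refine lintegral_mono fun v => ?_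
  rw [← ofReal_norm, Real.norm_of_nonneg (mul_nonneg (bw_nonneg p v) (norm_nonneg _))]

/-- `‖v‖^n ‖G v‖` is integrable for `G ∈ Nice`. [folklore] -/
theorem integrable_pow_mul_norm_of_nice {G : V → ℂ} (hG : Nice G) (n : ℕ) :
    Integrable (fun v : V => ‖v‖ ^ n * ‖G v‖) (volume : Measure V) :=
  (integrable_bw_mul_norm_of_nice hG n).mono' ((continuous_norm.pow n).aestronglyMeasurable.mul hG.1.norm)
    (Eventually.of_forall fun v => by
      rw [Real.norm_of_nonneg (mul_nonneg (pow_nonneg (norm_nonneg v) n) (norm_nonneg _))]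
      exact mul_le_mul_of_nonneg_right (norm_pow_le_bw n v) (norm_nonneg _))

/-- A `Nice` function is integrable. [folklore] -/
theorem integrable_of_nice {G : V → ℂ} (hG : Nice G) : Integrable G (volume : Measure V) := by
  have h := integrable_pow_mul_norm_of_nice hG 0
  simp only [pow_zero, one_mul] at h
  exact h.congr' hG.1 (Eventually.of_forall fun v => by simp) |> fun h => by
    exact (integrable_norm_iff hG.1).1 (by simpa using integrable_pow_mul_norm_of_nice hG 0)

/-- **`𝓕 G` is smooth for `G ∈ Nice`.** [folklore] -/
theorem contDiff_fourier_of_nice {G : V → ℂ} (hG : Nice G) : ContDiff ℝ ∞ (𝓕 G) :=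
  Real.contDiff_fourier (N := (⊤ : ℕ∞)) fun n _ => integrable_pow_mul_norm_of_nice hG n

/-! ### The density -/

variable {E : Type*} [NormedAddCommGroup E] [NormedSpace ℝ E] {Ω : Opens E}
variable {u : 𝓓'(Ω, ℝ)} {ζ : 𝓓(Ω, ℝ)}

/-- The Schwartz function `ψ_φ = 𝓕⁻¹ q` for the Schwartz avatar `q` of a test function `φ`:
`conj (𝓕 ψ_φ (T x)) = φ x`. [folklore] -/
theorem conj_fourier_fourierInv_avatar {T : E →L[ℝ] V} {φ : E → ℝ} {q : 𝓢(V, ℂ)}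
    (hq : ∀ x, (φ x : ℂ) = q (T x)) (x : E) : conj (𝓕 (𝓕⁻ q : 𝓢(V, ℂ)) (T x)) = φ x := by
  rw [FourierTransform.fourier_fourierInv_eq, ← hq x, Complex.conj_ofReal]

/-- **The representation identity on test functions**: for `φ` with `ζ φ = φ` and Schwartz
avatar `q` (`φ = q ∘ T`), `u φ = Re (pairing G (𝓕⁻¹ q))`. [folklore] -/
theorem Rep.apply_eq_pairing {T : E →L[ℝ] V} {G : V → ℂ} (hG : Rep u ζ T G id)
    (φ : 𝓓(Ω, ℝ)) (hζφ : ∀ x, ζ x * φ x = φ x) {q : 𝓢(V, ℂ)} (hq : ∀ x, (φ x : ℂ) = q (T x)) :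
    (u φ : ℂ) = pairing G ((𝓕⁻ q : 𝓢(V, ℂ)) : V → ℂ) := by
  rw [hG.eq (𝓕⁻ q)]
  simp only [id]
  have e : (fun x => conj (𝓕 (𝓕⁻ q : 𝓢(V, ℂ)) (T x))) = fun x => ((φ x : ℝ) : ℂ) := by
    ext x; exact conj_fourier_fourierInv_avatar hq x
  rw [e, uC_eq u ζ (h := fun x => ((φ x : ℝ) : ℂ)) (Complex.ofRealCLM.contDiff.comp φ.contDiff)]
  have e1 : mulSmooth ζ (fun x => ((φ x : ℝ) : ℂ).re) (Complex.reCLM.contDiff.comp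
      (Complex.ofRealCLM.contDiff.comp φ.contDiff)) = φ := by
    ext x; simp [hζφ x]
  have e2 : mulSmooth ζ (fun x => ((φ x : ℝ) : ℂ).im) (Complex.imCLM.contDiff.comp
      (Complex.ofRealCLM.contDiff.comp φ.contDiff)) = 0 := by
    ext x; simp
  rw [e1, e2, map_zero]
  simp

/-- **The density**: `pairing G (𝓕⁻¹ q) = c_T⁻¹ ∫ (𝓕 G)(T x) φ(x) dμ`, by the change of
variables and Fubini. [folklore] -/
theorem pairing_fourierInv_avatar [MeasurableSpace E] [BorelSpace E] {μ : Measure E} [SigmaFinite μ]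
    {T : E →L[ℝ] V} {G : V → ℂ}
    (hG : Nice G) {cT : ℂ} (hcT : cT ≠ 0) (hT : ∀ g : V → ℂ, ∫ x, g (T x) ∂μ = cT * ∫ y, g y)
    {φ : E → ℝ} (hφc : Continuous φ) (hφs : HasCompactSupport φ) [IsFiniteMeasureOnCompacts μ]
    {q : 𝓢(V, ℂ)} (hq : ∀ x, (φ x : ℂ) = q (T x)) :
    pairing G ((𝓕⁻ q : 𝓢(V, ℂ)) : V → ℂ) = cT⁻¹ * ∫ x, 𝓕 G (T x) * φ x ∂μ := by
  -- the phase
  set eχ : E → V → ℂ := fun x ξ => Complex.exp ((↑(-2 * π * ⟪T x, ξ⟫_ℝ) * Complex.I)) with heχ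
  -- `conj (𝓕⁻ q ξ) = ∫ e^{-2πi⟨y,ξ⟩} conj(q y) dy = c_T⁻¹ ∫ e^{-2πi⟨Tx,ξ⟩} φ x dμ`
  have hconj : ∀ ξ : V, conj ((𝓕⁻ q : 𝓢(V, ℂ)) ξ) = cT⁻¹ * ∫ x, eχ x ξ * φ x ∂μ := by
    intro ξ
    rw [SchwartzMap.fourierInv_coe, Real.fourierInv_eq', ← integral_conj]
    set g : V → ℂ := fun y => Complex.exp ((↑(-2 * π * ⟪y, ξ⟫_ℝ) * Complex.I)) * conj (q y) with hg
    have e1 : (fun y : V => conj (Complex.exp ((↑(2 * π * ⟪y, ξ⟫_ℝ) * Complex.I)) • (q : V → ℂ) y)) = g := by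
      ext y
      simp only [hg, smul_eq_mul, map_mul, ← Complex.exp_conj, Complex.conj_ofReal, Complex.conj_I]
      congr 1; push_cast; ring
    rw [e1]
    have h2 := hT g
    have e3 : (fun x => g (T x)) = fun x => eχ x ξ * φ x := by
      ext x; simp only [hg, heχ]; rw [← hq x, Complex.conj_ofReal]
    rw [e3] at h2
    rw [eq_inv_mul_iff_mul_eq₀ hcT, ← h2]
  -- Fubini on `volume × μ`
  unfold pairing
  simp_rw [hconj]
  have hGi : Integrable G volume := integrable_of_nice hG
  have hφi : Integrable (fun x => (φ x : ℂ)) μ :=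
    (hφc.integrable_of_hasCompactSupport hφs).ofReal
  set F : V → E → ℂ := fun ξ x => G ξ * (cT⁻¹ * (eχ x ξ * φ x)) with hF
  have hFi : Integrable (uncurry F) (volume.prod μ) := by
    have hm : AEStronglyMeasurable (uncurry F) (volume.prod μ) := by
      have h1 : AEStronglyMeasurable (fun p : V × E => G p.1) (volume.prod μ) := hG.1.comp_fst
      have h2 : Continuous fun p : V × E => cT⁻¹ * (eχ p.2 p.1 * φ p.2) := by
        simp only [heχ]
        fun_prop
      exact h1.mul h2.aestronglyMeasurable
    have hbound : ∀ p : V × E, ‖uncurry F p‖ = ‖cT⁻¹‖ * (‖G p.1‖ * ‖(φ p.2 : ℂ)‖) := fun p => by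
      simp only [hF, heχ, uncurry, norm_mul, Complex.norm_exp_ofReal_mul_I, one_mul]; ring
    have hg : Integrable (fun p : V × E => ‖cT⁻¹‖ * (‖G p.1‖ * ‖(φ p.2 : ℂ)‖)) (volume.prod μ) :=
      ((hGi.norm).mul_prod (hφi.norm)).const_mul _
    exact hg.mono' hm (Eventually.of_forall fun p => (hbound p).le)
  have hswap := MeasureTheory.integral_integral_swap hFi
  have eL : ∫ ξ, G ξ * (cT⁻¹ * ∫ x, eχ x ξ * φ x ∂μ) = ∫ ξ, ∫ x, F ξ x ∂μ := by
    refine integral_congr_ae (Eventually.of_forall fun ξ => ?_)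
    simp only [hF]
    rw [← integral_const_mul, ← integral_const_mul]
  rw [eL, hswap, ← integral_const_mul]
  refine integral_congr_ae (Eventually.of_forall fun x => ?_)
  -- `∫ ξ, F ξ x = cT⁻¹ * 𝓕 G (T x) * φ x`
  show ∫ ξ, F ξ x = cT⁻¹ * (𝓕 G (T x) * (φ x : ℂ))
  rw [Real.fourier_eq']
  simp only [hF, heχ, smul_eq_mul]
  have e5 : (fun ξ => G ξ * (cT⁻¹ * (Complex.exp ((↑(-2 * π * ⟪T x, ξ⟫_ℝ) * Complex.I)) * ↑(φ x)))) =
      fun ξ => (cT⁻¹ * ↑(φ x)) * (Complex.exp ((↑(-2 * π * ⟪ξ, T x⟫_ℝ) * Complex.I)) * G ξ) := by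
    ext ξ; rw [real_inner_comm]; ring
  rw [e5, integral_const_mul]
  ring

/-- **Smoothness**: if `G ∈ Nice` represents the identity then `u` is the smooth function
`Re (c_T⁻¹ 𝓕G ∘ T)` on every open set where `ζ = 1`. [folklore] -/
theorem Rep.isSmoothOn [MeasurableSpace E] [BorelSpace E] {μ : Measure E} [SigmaFinite μ]
    {T : E →L[ℝ] V} {G : V → ℂ}
    (hG : Rep u ζ T G id) (hN : Nice G)
    {cT : ℂ} (hcT : cT ≠ 0) (hT : ∀ g : V → ℂ, ∫ x, g (T x) ∂μ = cT * ∫ y, g y)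
    [IsFiniteMeasureOnCompacts μ]
    (avatar : ∀ φ : 𝓓(Ω, ℝ), ∃ q : 𝓢(V, ℂ), ∀ x, ((φ x : ℝ) : ℂ) = q (T x))
    {U : Set E} (hζU : ∀ x ∈ U, ζ x = 1) :
    Literature.Analysis.Distribution.IsSmoothOn u μ U := by
  set g : E → ℝ := fun x => (cT⁻¹ * 𝓕 G (T x)).re with hg
  have hgs : ContDiff ℝ ∞ g := by
    have h1 : ContDiff ℝ ∞ (fun x => 𝓕 G (T x)) := (contDiff_fourier_of_nice hN).comp T.contDiff
    exact Complex.reCLM.contDiff.comp (contDiff_const.mul h1)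
  refine ⟨g, hgs.contDiffOn, fun φ hφ => ?_⟩
  obtain ⟨q, hq⟩ := avatar φ
  have hζφ : ∀ x, ζ x * φ x = φ x := fun x => by
    by_cases hx : x ∈ tsupport (φ : E → ℝ)
    · rw [hζU x (hφ hx), one_mul]
    · rw [image_eq_zero_of_notMem_tsupport hx, mul_zero]
  have h1 := hG.apply_eq_pairing φ hζφ hq
  rw [pairing_fourierInv_avatar hN hcT hT φ.contDiff.continuous φ.hasCompactSupport hq] at h1
  -- take real parts
  have h2 := congrArg Complex.re h1
  rw [Complex.ofReal_re] at h2
  rw [h2, hg]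
  -- `Re (cT⁻¹ ∫ 𝓕G(Tx) φ x) = ∫ Re(cT⁻¹ 𝓕G(Tx)) φ x`
  have hint : Integrable (fun x => cT⁻¹ * (𝓕 G (T x) * (φ x : ℂ))) μ := by
    have hc : Continuous fun x => cT⁻¹ * (𝓕 G (T x) * (φ x : ℂ)) :=
      continuous_const.mul (((contDiff_fourier_of_nice hN).continuous.comp T.continuous).mul
        (Complex.continuous_ofReal.comp φ.contDiff.continuous))
    refine hc.integrable_of_hasCompactSupport ?_
    exact (φ.hasCompactSupport.comp_left Complex.ofReal_zero).mul_left.mul_left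
  rw [← integral_const_mul, show (∫ x, cT⁻¹ * (𝓕 G (T x) * (φ x : ℂ)) ∂μ).re =
    Complex.reCLM (∫ x, cT⁻¹ * (𝓕 G (T x) * (φ x : ℂ)) ∂μ) from rfl,
    ← ContinuousLinearMap.integral_comp_comm _ hint]
  refine integral_congr_ae (Eventually.of_forall fun x => ?_)
  simp only [Complex.reCLM_apply, ← mul_assoc, Complex.mul_re, Complex.ofReal_re, Complex.ofReal_im,
    mul_zero, sub_zero]

end Literature.Analysis.Hypoelliptic
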